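import Summits.FinalStateConjecture.FinalStateConjecture.Statement
import Literature.Geometry.Lorentzian.FinalEraPackage2
import Summits.FinalStateConjecture.FinalStateConjecture.Theorems.DissipativeFinalMotionsDispersingCaptureStubAsymptoticVelocity
import Summits.FinalStateConjecture.FinalStateConjecture.Theorems.DissipativeFinalMotionsDispersingCaptureStubSeparation
import Summits.FinalStateConjecture.FinalStateConjecture.Theorems.DissipativeFinalMotionsDispersingCaptureStubBoostTransport
import Summits.FinalStateConjecture.FinalStateConjecture.Theorems.DissipativeFinalMotionsDispersingCaptureStubOrientedAssembly
import HarnessLib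

/-!
# Stub C `stub_captureOfSettled` — capture of a dispersing era GIVEN rest-frame settled charts
# (crux `DispersingCapture`, stmt-FinalStateConjecture-17643, line `registered`, skeleton r6; lead prover c3, 2026-08-17)

Route `DissipativeFinalMotions` of the summit `FinalStateConjecture`. The rev-3 crux `DispersingCapture` was
found UNDER-HYPOTHESISED by three successive leads (c1, c2, c3): for any witness decomposition built from
the package charts, the exhaustion clause of the Statement's `HasExhaustiveCharts` is not derivable from
`IsFinalEra₂` + (R) + (F) + (F₀) + dispersal (deep flat-charted points under the package-legal skew of the
hole and flat clocks; `Cruxes/DispersingCapture/Lines/birth-dead*.md`, `Lines/birth-c3.md`). The line's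
skeleton r6 therefore cuts the crux at that seam: E `stub_escapeRate` (GR input) → B₁
`stub_restFrameSettledData` (crux hypotheses at `N = n + 1` ⇒ rest-frame Statement-shaped settled charts:
a late time `T₁`, a sublinear tube profile `ρ`, honest radii `R`, a thinned flat domain `U₁` with a flat
chart `Φ₀` that is `C²`-flat on WHOLE slabs, region identity and growing-zone exhaustion — THE GAP) → C
`stub_captureOfSettled` (this file, PROVED): package + such settled charts `(T₁, ρ, R, U₁, Φ₀)` + (R) + (F)
+ dispersal + integrable escape rates ⇒ the crux's conclusion, for EVERY `N`.

C is the composition of the landed pieces A `stub_asymptoticVelocity` (p145569: escape rates + worldline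
clauses ⇒ Cesàro velocities), B_sep `stub_separation` (p149503: package + dispersal ⇒ separation at every
radius), B₂a `stub_boostTransport` (p149957: transport to the boosted exteriors of the pure boosts) and
B₂b `stub_orientedAssembly` (p149167: assembly of the witness with all five conjuncts); no case split on
`N` is needed. The Cesàro form `captureOfSettled_of_cesaro` (velocities as a hypothesis instead of the
escape rates; no GR input at all) is proved first and C is its corollary through A. Neither uses
admissibility, maximality or completeness of `𝓘⁺`.

USE (planner, rev 4 of the crux). The settled charts must be NEW binders `(T₁, ρ, R, U₁, Φ₀)` — a flat chart
`Φ₀` on a THINNED domain `U₁` (intended: `Ψ₀` restricted to `U₀ ∖ ⋃ᵢ {distᵢ ≤ ρ(t)}`), not the package's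
own `(U₀, Ψ₀)`: full-slab `C²` flatness of `Ψ₀` on `U₀ ⊇ {t > T, distᵢ > ρ₀}` ((F2), constant `ρ₀`) is
jointly UNSATISFIABLE with the package for `N ≥ 1` (a point at flat distance `ρ₀ + 1` from a hole is
hole-charted at bounded Kerr–Schild radius by (X3), where the hole chart converges in `C²` to Kerr, which
is nowhere flat — curvature is chart-independent), so a restatement over
`CauchyDevelopment.IsRestFrameSettled … B₀ … Ψ₀ …` (same flat chart) would be vacuous for `N ≥ 1`. With
the ten clauses below as hypotheses (binders `T₁ ρ R U₁ Φ₀` appended to the crux), the restated crux closes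
by `exact stub_captureOfSettled …` given the escape rates, or by `exact captureOfSettled_of_cesaro …`
given Cesàro velocities.

References: Dafermos–Luk arXiv:1710.01722, p. 8 and Conjecture 1; DHRT arXiv:2104.08222, §1; O'Neill
1983, Ch. 9 (Lorentz boosts) and Ch. 14 (causality); Marchal–Saari, J. Differential Equations 20 (1976).
-/

set_option linter.dupNamespace false

noncomputable section

open scoped Manifold ContDiff Topology
open Filter Set Function MeasureTheory Literature.Geometry.Lorentzian

namespace Summit.FinalStateConjecture.FinalStateConjecture.Theorems.DissipativeFinalMotions.DispersingCapture

/-- **Capture of a dispersing era with rest-frame settled charts and Cesàro velocities.** On a vacuum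
Cauchy development let `(N, M, a, T, …, U₀, B₀, B, Ψ₀, Ψ, O)` satisfy the 31-clause rev-2 package
`IsFinalEra₂`, and let `(T₁, ρ, R, U₁, Φ₀)` be rest-frame settled charts for it: `Φ₀` a late chart into
`O` after `T₁` on the Minkowski background over `U₁`, the hole charts `Ψᵢ` late charts into `O` after
`T₁`, `ρ(t)/t → 0`, `U₁ ⊇ {t > T₁} ∖ ⋃ᵢ {distᵢ ≤ ρ(t)}`, `Φ₀^* g → η` in `C²` on whole slabs, honest radii
`Rᵢ → ∞`, `Rᵢ ≥ max(r₊(Mᵢ,aᵢ),0) + 1` with `Ψᵢ^* g → g₀` in `C²` out to `Rᵢ(τ)`,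
`O = J⁺(ιX) ∩ I⁻(Φ₀(late T₁) ∪ ⋃ᵢ Ψᵢ(late T₁))`, exhaustion of `O` for every `τ₁ > T₁` by the flat late
region and the growing zones up to the causal past of the certified slab, and eventual
future-directedness of `dΦ₀(∂₀)` on whole flat slabs. If moreover (R) `RaysStayInClosure 𝒟 O`, (F)
`dΨᵢ(V_{Mᵢ,aᵢ})` is eventually future-directed on every truncated slab, the labels pairwise disperse
and the worldlines have Cesàro velocities `t⁻¹ξᵢ(t) → vᵢ`, `‖vᵢ‖ ≤ V`, then the re-typed Statement's
conclusion holds for `𝒟` (`∃ O' d`, sub-extremal holes, `O' = exteriorOf 𝒟 d.charted`,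
`RaysStayInClosure 𝒟 O'`, `HasExhaustiveCharts d`, `IsFutureOriented d`). Proof: separation at every
radius from the package and dispersal (`stub_separation`); substitute the hole backgrounds (clause (B));
transport everything to the boosted exteriors of the pure boosts of the `vᵢ` (`stub_boostTransport`,
`V < 1` is clause 7); assemble (`stub_orientedAssembly`, sub-extremality is clause 4). Dafermos–Luk
arXiv:1710.01722, Conjecture 1; O'Neill 1983, Ch. 9 and Ch. 14; DHRT arXiv:2104.08222, §1. -/
theorem captureOfSettled_of_cesaro : open scoped Manifold Topology in ∀ (X : Type) [TopologicalSpace X] [ChartedSpace (EuclideanSpace ℝ (Fin 3)) X] [IsManifold (𝓡 3) ((⊤ : ℕ∞) : WithTop ℕ∞) X] [T2Space X] [SecondCountableTopology X] [ConnectedSpace X], ∀ (D : Literature.Geometry.Lorentzian.InitialDataSet (𝓡 3) X) (𝒟 : Literature.Geometry.Lorentzian.VacuumCauchyDevelopment D) (N : ℕ) (M a : Fin N → ℝ) (T δ V C₁ C₂ ρ₀ κ : ℝ) (ξ : Fin N → ℝ → EuclideanSpace ℝ (Fin 3)) (β : ℝ → ℝ) (U₀ : TopologicalSpace.Opens Literature.Geometry.Lorentzian.E4)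 (B₀ : Literature.Geometry.Lorentzian.ModelBackground) (B : Fin N → Literature.Geometry.Lorentzian.ModelBackground) (Ψ₀ : B₀.domain → 𝒟.carrier) (Ψ : (i : Fin N) → (B i).domain → 𝒟.carrier) (O : Set 𝒟.carrier) (T₁ : ℝ) (ρ : ℝ → ℝ) (R : Fin N → ℝ → ℝ) (U₁ : TopologicalSpace.Opens Literature.Geometry.Lorentzian.E4) (Φ₀ : (Literature.Geometry.Lorentzian.Minkowski.backgroundOn U₁).domain → 𝒟.carrier), 𝒟.toCauchyDevelopment.IsFinalEra₂ N M a T δ V C₁ C₂ ρ₀ κ ξ β U₀ B₀ B Ψ₀ Ψ O → 𝒟.toSpacetime.IsLateChart (Literature.Geometry.Lorentzian.Minkowski.backgroundOn U₁) O T₁ Φ₀ → (∀ i, 𝒟.toSpacetime.IsLateChart (B i) O T₁ (Ψ i)) → Filter.Tendsto (fun t ↦ ρ t / t) Filter.atTop (nhds 0) → {y : Literature.Geometry.Lorentzian.E4 | T₁ < y 0 ∧ ∀ i, ρ (y 0) < ‖Literature.Geometry.Lorentzian.E4.spatial y - ξ i (y 0)‖} ⊆ (U₁ : Set Literature.Geometry.Lorentzian.E4)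 → Filter.Tendsto (fun τ ↦ 𝒟.toSpacetime.deviationCk (Literature.Geometry.Lorentzian.Minkowski.backgroundOn U₁) Φ₀ 2 τ) Filter.atTop (nhds 0) → (∀ i, Filter.Tendsto (R i) Filter.atTop Filter.atTop ∧ ∀ τ, max (Literature.Geometry.Lorentzian.Kerr.rPlus (M i) (a i)) 0 + 1 ≤ R i τ) → (∀ i, Filter.Tendsto (fun τ ↦ 𝒟.toSpacetime.truncDeviationCk (B i) (Ψ i) 2 (R i τ) τ) Filter.atTop (nhds 0)) → O = Summit.FinalStateConjecture.exteriorOf 𝒟.toCauchyDevelopment (Φ₀ '' (Literature.Geometry.Lorentzian.Minkowski.backgroundOn U₁).lateRegion T₁ ∪ ⋃ i, Ψ i '' (B i).lateRegion T₁) → (∀ τ₁, T₁ < τ₁ → O \ (Φ₀ '' (Literature.Geometry.Lorentzian.Minkowski.backgroundOn U₁).lateRegion τ₁ ∪ ⋃ i, Ψ i '' {x : (B i).domain | τ₁ < (B i).time x.1 ∧ (B i).radius x.1 ≤ R i ((B i).time x.1)}) ⊆ 𝒟.toSpacetime.metric.causalPast 𝒟.toSpacetime.timeOrientation (Φ₀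 '' (Literature.Geometry.Lorentzian.Minkowski.backgroundOn U₁).timeSlab τ₁ ∪ ⋃ i, Ψ i '' (B i).truncTimeSlab (R i τ₁) τ₁)) → (∀ᶠ τ in Filter.atTop, ∀ x ∈ (Literature.Geometry.Lorentzian.Minkowski.backgroundOn U₁).timeSlab τ, 𝒟.toSpacetime.timeOrientation.IsFutureDirected (mfderiv 𝓘(ℝ, Literature.Geometry.Lorentzian.E4) (𝓡 4) Φ₀ x (Literature.Geometry.Lorentzian.E4.basisVector 0))) → Summit.FinalStateConjecture.RaysStayInClosure 𝒟.toCauchyDevelopment O → (∀ i (ρ' : ℝ), ∀ᶠ τ in Filter.atTop, ∀ x ∈ (B i).truncTimeSlab ρ' τ, 𝒟.toSpacetime.timeOrientation.IsFutureDirected (mfderiv 𝓘(ℝ, Literature.Geometry.Lorentzian.E4) (𝓡 4) (Ψ i) x (Literature.Geometry.Lorentzian.Kerr.timeVector (M i) (a i) x.1))) → (∀ i j, i ≠ j → Filter.Tendsto (fun t ↦ ‖ξ i t - ξ j t‖) Filter.atTop Filter.atTop) → (∀ i, ∃ v : EuclideanSpace ℝ (Fin 3), ‖v‖ ≤ V ∧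 Filter.Tendsto (fun t : ℝ ↦ t⁻¹ • ξ i t) Filter.atTop (nhds v)) → ∃ (O' : Set 𝒟.carrier) (d : Literature.Geometry.Lorentzian.FinalStateDecomposition 𝒟.toSpacetime O' 2), (∀ i, Literature.Geometry.Lorentzian.Kerr.IsSubextremal (d.mass i) (d.spin i)) ∧ O' = Summit.FinalStateConjecture.exteriorOf 𝒟.toCauchyDevelopment d.charted ∧ Summit.FinalStateConjecture.RaysStayInClosure 𝒟.toCauchyDevelopment O' ∧ Summit.FinalStateConjecture.HasExhaustiveCharts d ∧ Summit.FinalStateConjecture.IsFutureOriented d := by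
  intro X _ _ _ _ _ _ D 𝒟 N M a T δ V C₁ C₂ ρ₀ κ ξ β U₀ B₀ B Ψ₀ Ψ O T₁ ρ R U₁ Φ₀ hera hΦ₀ hΨ hS1 hS2 hS3 hS4
    hS5 hO hS6 hS7 hrays hholes hdisp hvel
  -- (B_sep): separation of the rest-frame tubes at every radius, from the package and dispersal
  have hsep : ∀ R' : ℝ, ∃ τ' : ℝ,
      Pairwise (Function.onFun Disjoint fun i ↦ Ψ i '' (B i).truncLateRegion τ' R') :=
    stub_separation X D 𝒟 N M a T δ V C₁ C₂ ρ₀ κ ξ β U₀ B₀ B Ψ₀ Ψ O hera hdisp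
  -- the package clauses used directly: (B) hole backgrounds, (P) sub-extremality and `V < 1`
  obtain ⟨-, -, hB, hsub, -, -, hV1, -⟩ := hera
  choose v hv using hvel
  subst hB
  -- (B₂a): transport to the boosted exteriors of the pure boosts of the `vᵢ`
  obtain ⟨mo, ψ, ρexc, hψ, hconvb, hsepb, hρexc, hU₁b, horth, hFb, hOb, hexhb⟩ :=
    stub_boostTransport X D 𝒟 N M a T₁ V ξ v O U₁ Φ₀ Ψ ρ R hV1 (fun i ↦ (hv i).1)
      (fun i ↦ (hv i).2) hΨ hS1 hS2 (fun i ↦ (hS4 i).1) hS5 hsep hO hS6 hholes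
  -- (B₂b): assemble the witness
  exact stub_orientedAssembly X D 𝒟 N M a T₁ O U₁ Φ₀ mo ψ ρexc R hsub hΦ₀ hS3 hS7 hS4 hψ hconvb hsepb
    hρexc hU₁b horth hFb hOb hexhb hrays

/-- **C — CAPTURE OF A DISPERSING ERA GIVEN REST-FRAME SETTLED CHARTS** (crux `DispersingCapture`, line
`registered`, registered stub `stub_captureOfSettled` of skeleton r6). As `captureOfSettled_of_cesaro`, with
the Cesàro velocities replaced by integrable pairwise escape rates `1/‖ξᵢ − ξⱼ‖² ∈ L¹[T, ∞)` (`i ≠ j`) —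
the output of the GR input E of the line (linear-momentum balance; Chazy–Marchal–Saari rates `dᵢⱼ ≍ t`
or `t^{2/3}` of dispersing near-Newtonian systems). The velocities come from A (`stub_asymptoticVelocity`)
fed with the worldline clauses (P) `0 < δ`, (W1)–(W4) of the package and the rates. Dafermos–Luk
arXiv:1710.01722, Conjecture 1; Marchal–Saari, J. Differential Equations 20 (1976), 150–186. -/
theorem stub_captureOfSettled : open scoped Manifold Topology in ∀ (X : Type) [TopologicalSpace X] [ChartedSpace (EuclideanSpace ℝ (Fin 3)) X] [IsManifold (𝓡 3) ((⊤ : ℕ∞) : WithTop ℕ∞) X] [T2Space X] [SecondCountableTopology X] [ConnectedSpace X], ∀ (D : Literature.Geometry.Lorentzian.InitialDataSet (𝓡 3) X) (𝒟 : Literature.Geometry.Lorentzian.VacuumCauchyDevelopment D) (N : ℕ) (M a : Fin N → ℝ) (T δ V C₁ C₂ ρ₀ κ : ℝ) (ξ : Fin N → ℝ → EuclideanSpace ℝ (Fin 3)) (β : ℝ → ℝ) (U₀ : TopologicalSpace.Opens Literature.Geometry.Lorentzian.E4) (B₀ : Literature.Geometry.Lorentzian.ModelBackground) (B : Fin N →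 Literature.Geometry.Lorentzian.ModelBackground) (Ψ₀ : B₀.domain → 𝒟.carrier) (Ψ : (i : Fin N) → (B i).domain → 𝒟.carrier) (O : Set 𝒟.carrier) (T₁ : ℝ) (ρ : ℝ → ℝ) (R : Fin N → ℝ → ℝ) (U₁ : TopologicalSpace.Opens Literature.Geometry.Lorentzian.E4) (Φ₀ : (Literature.Geometry.Lorentzian.Minkowski.backgroundOn U₁).domain → 𝒟.carrier), 𝒟.toCauchyDevelopment.IsFinalEra₂ N M a T δ V C₁ C₂ ρ₀ κ ξ β U₀ B₀ B Ψ₀ Ψ O → 𝒟.toSpacetime.IsLateChart (Literature.Geometry.Lorentzian.Minkowski.backgroundOn U₁) O T₁ Φ₀ → (∀ i, 𝒟.toSpacetime.IsLateChart (B i) O T₁ (Ψ i)) → Filter.Tendsto (fun t ↦ ρ t / t) Filter.atTop (nhds 0) → {y : Literature.Geometry.Lorentzian.E4 | T₁ < y 0 ∧ ∀ i, ρ (y 0) < ‖Literature.Geometry.Lorentzian.E4.spatial y - ξ i (y 0)‖} ⊆ (U₁ : Set Literature.Geometry.Lorentzian.E4) → Filter.Tendsto (fun τ ↦ 𝒟.toSpacetime.deviationCk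 (Literature.Geometry.Lorentzian.Minkowski.backgroundOn U₁) Φ₀ 2 τ) Filter.atTop (nhds 0) → (∀ i, Filter.Tendsto (R i) Filter.atTop Filter.atTop ∧ ∀ τ, max (Literature.Geometry.Lorentzian.Kerr.rPlus (M i) (a i)) 0 + 1 ≤ R i τ) → (∀ i, Filter.Tendsto (fun τ ↦ 𝒟.toSpacetime.truncDeviationCk (B i) (Ψ i) 2 (R i τ) τ) Filter.atTop (nhds 0)) → O = Summit.FinalStateConjecture.exteriorOf 𝒟.toCauchyDevelopment (Φ₀ '' (Literature.Geometry.Lorentzian.Minkowski.backgroundOn U₁).lateRegion T₁ ∪ ⋃ i, Ψ i '' (B i).lateRegion T₁) → (∀ τ₁, T₁ < τ₁ → O \ (Φ₀ '' (Literature.Geometry.Lorentzian.Minkowski.backgroundOn U₁).lateRegion τ₁ ∪ ⋃ i, Ψ i '' {x : (B i).domain | τ₁ < (B i).time x.1 ∧ (B i).radius x.1 ≤ R i ((B i).time x.1)}) ⊆ 𝒟.toSpacetime.metric.causalPast 𝒟.toSpacetime.timeOrientation (Φ₀ '' (Literature.Geometry.Lorentzian.Minkowski.backgroundOn U₁).timeSlab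 τ₁ ∪ ⋃ i, Ψ i '' (B i).truncTimeSlab (R i τ₁) τ₁)) → (∀ᶠ τ in Filter.atTop, ∀ x ∈ (Literature.Geometry.Lorentzian.Minkowski.backgroundOn U₁).timeSlab τ, 𝒟.toSpacetime.timeOrientation.IsFutureDirected (mfderiv 𝓘(ℝ, Literature.Geometry.Lorentzian.E4) (𝓡 4) Φ₀ x (Literature.Geometry.Lorentzian.E4.basisVector 0))) → Summit.FinalStateConjecture.RaysStayInClosure 𝒟.toCauchyDevelopment O → (∀ i (ρ' : ℝ), ∀ᶠ τ in Filter.atTop, ∀ x ∈ (B i).truncTimeSlab ρ' τ, 𝒟.toSpacetime.timeOrientation.IsFutureDirected (mfderiv 𝓘(ℝ, Literature.Geometry.Lorentzian.E4) (𝓡 4) (Ψ i) x (Literature.Geometry.Lorentzian.Kerr.timeVector (M i) (a i) x.1))) → (∀ i j, i ≠ j → Filter.Tendsto (fun t ↦ ‖ξ i t - ξ j t‖) Filter.atTop Filter.atTop) → (∀ i j, i ≠ j → MeasureTheory.IntegrableOn (fun t ↦ 1 / ‖ξ i t - ξ j t‖ ^ 2) (Set.Ici T)) → ∃ (O' : Set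 𝒟.carrier) (d : Literature.Geometry.Lorentzian.FinalStateDecomposition 𝒟.toSpacetime O' 2), (∀ i, Literature.Geometry.Lorentzian.Kerr.IsSubextremal (d.mass i) (d.spin i)) ∧ O' = Summit.FinalStateConjecture.exteriorOf 𝒟.toCauchyDevelopment d.charted ∧ Summit.FinalStateConjecture.RaysStayInClosure 𝒟.toCauchyDevelopment O' ∧ Summit.FinalStateConjecture.HasExhaustiveCharts d ∧ Summit.FinalStateConjecture.IsFutureOriented d := by
  intro X _ _ _ _ _ _ D 𝒟 N M a T δ V C₁ C₂ ρ₀ κ ξ β U₀ B₀ B Ψ₀ Ψ O T₁ ρ R U₁ Φ₀ hera hΦ₀ hΨ hS1 hS2 hS3 hS4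
    hS5 hO hS6 hS7 hrays hholes hdisp hesc
  -- (A): Cesàro velocities from the worldline clauses (5, 12, 13, 14, 15, 17) and the escape rates
  obtain ⟨-, -, -, -, hδ, -, -, -, -, -, -, hC2, hfloor, hLip, hβ, -, hmod, -⟩ := id hera
  have hvel : ∀ i, ∃ v : EuclideanSpace ℝ (Fin 3), ‖v‖ ≤ V ∧
      Tendsto (fun t : ℝ ↦ t⁻¹ • ξ i t) atTop (𝓝 v) := fun i ↦ by
    obtain ⟨v, hv, -, hces⟩ := stub_asymptoticVelocity N M T δ V κ ξ β hδ hC2 hfloor hLip hβ hmod hesc i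
    exact ⟨v, hv, hces⟩
  exact captureOfSettled_of_cesaro X D 𝒟 N M a T δ V C₁ C₂ ρ₀ κ ξ β U₀ B₀ B Ψ₀ Ψ O T₁ ρ R U₁ Φ₀ hera hΦ₀
    hΨ hS1 hS2 hS3 hS4 hS5 hO hS6 hS7 hrays hholes hdisp hvel

end Summit.FinalStateConjecture.FinalStateConjecture.Theorems.DissipativeFinalMotions.DispersingCapture

end
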